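import Summits.HubbardSuperconductivity.HubbardSuperconductivity.Theses.AnisotropyChord
import Summits.HubbardSuperconductivity.HubbardSuperconductivity.Theorems.AnisotropyChordChordToOrderXY

/-!
# Crux `ChordFM` (stmt-HubbardSuperconductivity-8147) — birth skeleton of the PIECE `FerroSideChord`
# line `fm-monotone-anchor` (crux-strategist, 2026-08-17): the FM-side piece refined into three stubs,
# composed with the AF-side piece `stub_chordXY` to the crux `ChordFM` by name

`FerroSideChord` (piece 2 of the typed decomposition `ChordFM ⇐ ChordXY ∧ FerroSideChord`): for every
even `M ≥ 4`, every `Δ ∈ [0,1]` and every normalised `S^z_tot = 0` sector ground state `ψ` of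
`H_M(Δ) = xxzHamiltonian 1 (torusGraph 2 M) (-1) Δ`: `((1+Δ)/2)·S(S+1) ≤ Λ(ψ)`, `S = M²/2`,
`Λ(ψ) = Re⟨ψ, S⁺_tot S⁻_tot ψ⟩`.

Line (three stubs of three different kinds, all on the FERROMAGNETIC side where every coupling is
ferromagnetic and the sector ground state is the Perron vector):
* `stub_monotoneFM` — Griffiths-II-type MONOTONICITY in the ferromagnetic Ising coupling: for
  `0 ≤ Δ₁ ≤ Δ₂ ≤ 1` the condensate of the sector ground state does not decrease
  (`Λ(ψ₁) ≤ Λ(ψ₂)`). Known for classical rotators (Kunz–Pfister–Vuillermot 1976); for S=½ the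
  Ginibre/BLU inequalities cover couplings in two spin directions only (BLU 2016, arXiv:1611.06019)
  — the three-direction case is the open content. ED (card, 4×4): Λ increasing on [0,1].
* `stub_klsAnchor` — the SHARP reflection-positivity-free anchor at the KLS point with room to
  spare: `Λ(ψ₀) ≥ (7/10)·S(S+1)` at every even `M ≥ 4` (M = 4: 0.944·S(S+1) by ED; M = ∞:
  0.764·S(S+1) from QMC m = 0.437, Sandvik–Hamer 1999) — 8 % slack at M = ∞; the constant 7/10 is
  a line parameter (any θ with an FM-end stub on [2θ-1, 1] works), flagged hand-picked (4c(iv)).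
* `stub_fmEndChord` — the chord from the exact ferromagnetic value on the FM END `Δ ∈ [2/5, 1]`
  only (dilute / condensed magnon regime; Bogoliubov–LSW depletion slope 1/(4π) < 1/8 at M = ∞,
  flat at Δ = 1 at fixed M since the Dicke state maximises Λ, Tóth 1991).
Composition `FerroSideChord_of`: `Δ ≥ 2/5` is the FM-end stub; for `Δ < 2/5` monotonicity from the
KLS point (at an existing normalised sector ground state `ψ₀` of `H_M(0)`,
`exists_unit_sectorGroundState_xy`) and the anchor give `Λ(ψ) ≥ Λ(ψ₀) ≥ (7/10)S(S+1) ≥ ((1+Δ)/2)S(S+1)`.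

Shape (2026-08-17, session 5): the pieces are now ROUTE ITEMS referred to BY NAME — `ChordXY` (stmt-8146) and
`FerroSideChord` (stmt-19089, filed by this seat together with the glue item `ChordFMOfPieces`, stmt-19090).
Disproof used: none (no Disproof.lean exists for ChordFM yet). The STUCK-goal dodge: this line never
compares to the XY VALUE on (0,1) (the M=∞ curve is convex there, refuter g3 evidence on stmt-8150),
only to the FM value and through monotonicity.
-/

namespace Summit.HubbardSuperconductivity.HubbardSuperconductivity.Cruxes.ChordFM.FmMonotoneAnchor

open Matrix Literature.MathematicalPhysics.QuantumLattice Literature.Probability.LatticeModels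
open Summit.HubbardSuperconductivity.HubbardSuperconductivity.Theses.AnisotropyChord
open Summit.HubbardSuperconductivity.HubbardSuperconductivity.Theorems.AnisotropyChord
  (exists_unit_sectorGroundState_xy)

/-- STUB 0 = piece `ChordXY` (the route's Tier-A crux stmt-HubbardSuperconductivity-8146, BY NAME;
shared with line `split-chordxy-ferroside`). -/
theorem stub_chordXY : ChordXY := by
  sorry

/-- STUB 1 — Griffiths-II-type monotonicity of the sector ground-state condensate in the
ferromagnetic Ising coupling on `[0,1]`. -/
theorem stub_monotoneFM :
    ∀ (M : ℕ) [NeZero M], Even M → 4 ≤ M → ∀ (Δ₁ Δ₂ : ℝ), 0 ≤ Δ₁ → Δ₁ ≤ Δ₂ → Δ₂ ≤ 1 → ∀ (ψ₁ ψ₂ : Literature.MathematicalPhysics.QuantumLattice.TensorIndex (Literature.Probability.LatticeModels.TorusSite 2 M) 2 → ℂ), ψ₁ ∈ Literature.MathematicalPhysics.QuantumLattice.spinZSector (Λ := Literature.Probability.LatticeModels.TorusSite 2 M) 1 0 → star ψ₁ ⬝ᵥ ψ₁ = 1 → Matrix.mulVec (Literature.MathematicalPhysics.QuantumLattice.xxzHamiltonian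 1 (Literature.Probability.LatticeModels.torusGraph 2 M) (-1) Δ₁) ψ₁ = ((Literature.MathematicalPhysics.QuantumLattice.lowestEnergyInSector 1 (Literature.MathematicalPhysics.QuantumLattice.xxzHamiltonian 1 (Literature.Probability.LatticeModels.torusGraph 2 M) (-1) Δ₁) 0 : ℝ) : ℂ) • ψ₁ → ψ₂ ∈ Literature.MathematicalPhysics.QuantumLattice.spinZSector (Λ := Literature.Probability.LatticeModels.TorusSite 2 M) 1 0 → star ψ₂ ⬝ᵥ ψ₂ = 1 → Matrix.mulVec (Literature.MathematicalPhysics.QuantumLattice.xxzHamiltonian 1 (Literature.Probability.LatticeModels.torusGraph 2 M) (-1) Δ₂) ψ₂ = ((Literature.MathematicalPhysics.QuantumLattice.lowestEnergyInSector 1 (Literature.MathematicalPhysics.QuantumLattice.xxzHamiltonian 1 (Literature.Probability.LatticeModels.torusGraph 2 M) (-1) Δ₂) 0 : ℝ) : ℂ) • ψ₂ → (star ψ₁ ⬝ᵥ Matrix.mulVec ((∑ x : Literature.Probability.LatticeModels.TorusSite 2 M, Literature.MathematicalPhysics.QuantumLattice.onSite x (Literature.MathematicalPhysics.QuantumLattice.spinRaise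 1)) * (∑ y : Literature.Probability.LatticeModels.TorusSite 2 M, Literature.MathematicalPhysics.QuantumLattice.onSite y (Literature.MathematicalPhysics.QuantumLattice.spinLower 1))) ψ₁).re ≤ (star ψ₂ ⬝ᵥ Matrix.mulVec ((∑ x : Literature.Probability.LatticeModels.TorusSite 2 M, Literature.MathematicalPhysics.QuantumLattice.onSite x (Literature.MathematicalPhysics.QuantumLattice.spinRaise 1)) * (∑ y : Literature.Probability.LatticeModels.TorusSite 2 M, Literature.MathematicalPhysics.QuantumLattice.onSite y (Literature.MathematicalPhysics.QuantumLattice.spinLower 1))) ψ₂).re := by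
  sorry

/-- STUB 2 — sharp RP-free anchor at the KLS point: `Λ(ψ₀) ≥ (7/10)·S(S+1)` (line parameter θ = 7/10;
any θ composes with an FM-end stub on `[2θ-1, 1]`). -/
theorem stub_klsAnchor :
    ∀ (M : ℕ) [NeZero M], Even M → 4 ≤ M → ∀ (ψ₀ : Literature.MathematicalPhysics.QuantumLattice.TensorIndex (Literature.Probability.LatticeModels.TorusSite 2 M) 2 → ℂ), ψ₀ ∈ Literature.MathematicalPhysics.QuantumLattice.spinZSector (Λ := Literature.Probability.LatticeModels.TorusSite 2 M) 1 0 → star ψ₀ ⬝ᵥ ψ₀ = 1 → Matrix.mulVec (Literature.MathematicalPhysics.QuantumLattice.xxzHamiltonian 1 (Literature.Probability.LatticeModels.torusGraph 2 M) (-1) 0) ψ₀ = ((Literature.MathematicalPhysics.QuantumLattice.lowestEnergyInSector 1 (Literature.MathematicalPhysics.QuantumLattice.xxzHamiltonian 1 (Literature.Probability.LatticeModels.torusGraph 2 M) (-1) 0) 0 : ℝ) : ℂ) • ψ₀ → 7 / 10 * ((M : ℝ) ^ 2 / 2 * ((M : ℝ) ^ 2 / 2 + 1)) ≤ (star ψ₀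 ⬝ᵥ Matrix.mulVec ((∑ x : Literature.Probability.LatticeModels.TorusSite 2 M, Literature.MathematicalPhysics.QuantumLattice.onSite x (Literature.MathematicalPhysics.QuantumLattice.spinRaise 1)) * (∑ y : Literature.Probability.LatticeModels.TorusSite 2 M, Literature.MathematicalPhysics.QuantumLattice.onSite y (Literature.MathematicalPhysics.QuantumLattice.spinLower 1))) ψ₀).re := by
  sorry

/-- STUB 3 — the chord from the exact ferromagnetic value on the FM end `Δ ∈ [2/5, 1]`. -/
theorem stub_fmEndChord :
    ∀ (M : ℕ) [NeZero M], Even M → 4 ≤ M → ∀ Δ ∈ Set.Icc (2/5:ℝ) 1, ∀ (ψ : Literature.MathematicalPhysics.QuantumLattice.TensorIndex (Literature.Probability.LatticeModels.TorusSite 2 M) 2 → ℂ), ψ ∈ Literature.MathematicalPhysics.QuantumLattice.spinZSector (Λ := Literature.Probability.LatticeModels.TorusSite 2 M) 1 0 → star ψ ⬝ᵥ ψ = 1 → Matrix.mulVec (Literature.MathematicalPhysics.QuantumLattice.xxzHamiltonian 1 (Literature.Probability.LatticeModels.torusGraph 2 M) (-1) Δ) ψ = ((Literature.MathematicalPhysics.QuantumLattice.lowestEnergyInSector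 1 (Literature.MathematicalPhysics.QuantumLattice.xxzHamiltonian 1 (Literature.Probability.LatticeModels.torusGraph 2 M) (-1) Δ) 0 : ℝ) : ℂ) • ψ → (1 + Δ) / 2 * ((M : ℝ) ^ 2 / 2 * ((M : ℝ) ^ 2 / 2 + 1)) ≤ (star ψ ⬝ᵥ Matrix.mulVec ((∑ x : Literature.Probability.LatticeModels.TorusSite 2 M, Literature.MathematicalPhysics.QuantumLattice.onSite x (Literature.MathematicalPhysics.QuantumLattice.spinRaise 1)) * (∑ y : Literature.Probability.LatticeModels.TorusSite 2 M, Literature.MathematicalPhysics.QuantumLattice.onSite y (Literature.MathematicalPhysics.QuantumLattice.spinLower 1))) ψ).re := by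
  sorry

/-- COMPOSITION TO THE PIECE — the three FM-side stubs give the route item `FerroSideChord`
(stmt-HubbardSuperconductivity-19089) by name: `Δ ≥ 2/5` is the FM-end stub; for `Δ < 2/5`
monotonicity from the KLS point (at an existing normalised sector ground state `ψ₀` of `H_M(0)`)
and the anchor give `Λ(ψ) ≥ Λ(ψ₀) ≥ (7/10)S(S+1) ≥ ((1+Δ)/2)S(S+1)`. [folklore] -/
theorem ferroSideChord_of
    (hMono : ∀ (M : ℕ) [NeZero M], Even M → 4 ≤ M → ∀ (Δ₁ Δ₂ : ℝ), 0 ≤ Δ₁ → Δ₁ ≤ Δ₂ → Δ₂ ≤ 1 → ∀ (ψ₁ ψ₂ : Literature.MathematicalPhysics.QuantumLattice.TensorIndex (Literature.Probability.LatticeModels.TorusSite 2 M) 2 → ℂ), ψ₁ ∈ Literature.MathematicalPhysics.QuantumLattice.spinZSector (Λ := Literature.Probability.LatticeModels.TorusSite 2 M) 1 0 → star ψ₁ ⬝ᵥ ψ₁ = 1 → Matrix.mulVec (Literature.MathematicalPhysics.QuantumLattice.xxzHamiltonian 1 (Literature.Probability.LatticeModels.torusGraph 2 M) (-1) Δ₁)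 ψ₁ = ((Literature.MathematicalPhysics.QuantumLattice.lowestEnergyInSector 1 (Literature.MathematicalPhysics.QuantumLattice.xxzHamiltonian 1 (Literature.Probability.LatticeModels.torusGraph 2 M) (-1) Δ₁) 0 : ℝ) : ℂ) • ψ₁ → ψ₂ ∈ Literature.MathematicalPhysics.QuantumLattice.spinZSector (Λ := Literature.Probability.LatticeModels.TorusSite 2 M) 1 0 → star ψ₂ ⬝ᵥ ψ₂ = 1 → Matrix.mulVec (Literature.MathematicalPhysics.QuantumLattice.xxzHamiltonian 1 (Literature.Probability.LatticeModels.torusGraph 2 M) (-1) Δ₂) ψ₂ = ((Literature.MathematicalPhysics.QuantumLattice.lowestEnergyInSector 1 (Literature.MathematicalPhysics.QuantumLattice.xxzHamiltonian 1 (Literature.Probability.LatticeModels.torusGraph 2 M) (-1) Δ₂) 0 : ℝ) : ℂ) • ψ₂ → (star ψ₁ ⬝ᵥ Matrix.mulVec ((∑ x : Literature.Probability.LatticeModels.TorusSite 2 M, Literature.MathematicalPhysics.QuantumLattice.onSite x (Literature.MathematicalPhysics.QuantumLattice.spinRaise 1)) * (∑ y : Literature.Probability.LatticeModels.TorusSite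 2 M, Literature.MathematicalPhysics.QuantumLattice.onSite y (Literature.MathematicalPhysics.QuantumLattice.spinLower 1))) ψ₁).re ≤ (star ψ₂ ⬝ᵥ Matrix.mulVec ((∑ x : Literature.Probability.LatticeModels.TorusSite 2 M, Literature.MathematicalPhysics.QuantumLattice.onSite x (Literature.MathematicalPhysics.QuantumLattice.spinRaise 1)) * (∑ y : Literature.Probability.LatticeModels.TorusSite 2 M, Literature.MathematicalPhysics.QuantumLattice.onSite y (Literature.MathematicalPhysics.QuantumLattice.spinLower 1))) ψ₂).re)
    (hAnch : ∀ (M : ℕ) [NeZero M], Even M → 4 ≤ M → ∀ (ψ₀ : Literature.MathematicalPhysics.QuantumLattice.TensorIndex (Literature.Probability.LatticeModels.TorusSite 2 M) 2 → ℂ), ψ₀ ∈ Literature.MathematicalPhysics.QuantumLattice.spinZSector (Λ := Literature.Probability.LatticeModels.TorusSite 2 M) 1 0 → star ψ₀ ⬝ᵥ ψ₀ = 1 → Matrix.mulVec (Literature.MathematicalPhysics.QuantumLattice.xxzHamiltonian 1 (Literature.Probability.LatticeModels.torusGraph 2 M) (-1) 0) ψ₀ = ((Literature.MathematicalPhysics.QuantumLattice.lowestEnergyInSector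 1 (Literature.MathematicalPhysics.QuantumLattice.xxzHamiltonian 1 (Literature.Probability.LatticeModels.torusGraph 2 M) (-1) 0) 0 : ℝ) : ℂ) • ψ₀ → 7 / 10 * ((M : ℝ) ^ 2 / 2 * ((M : ℝ) ^ 2 / 2 + 1)) ≤ (star ψ₀ ⬝ᵥ Matrix.mulVec ((∑ x : Literature.Probability.LatticeModels.TorusSite 2 M, Literature.MathematicalPhysics.QuantumLattice.onSite x (Literature.MathematicalPhysics.QuantumLattice.spinRaise 1)) * (∑ y : Literature.Probability.LatticeModels.TorusSite 2 M, Literature.MathematicalPhysics.QuantumLattice.onSite y (Literature.MathematicalPhysics.QuantumLattice.spinLower 1))) ψ₀).re)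
    (hEnd : ∀ (M : ℕ) [NeZero M], Even M → 4 ≤ M → ∀ Δ ∈ Set.Icc (2/5:ℝ) 1, ∀ (ψ : Literature.MathematicalPhysics.QuantumLattice.TensorIndex (Literature.Probability.LatticeModels.TorusSite 2 M) 2 → ℂ), ψ ∈ Literature.MathematicalPhysics.QuantumLattice.spinZSector (Λ := Literature.Probability.LatticeModels.TorusSite 2 M) 1 0 → star ψ ⬝ᵥ ψ = 1 → Matrix.mulVec (Literature.MathematicalPhysics.QuantumLattice.xxzHamiltonian 1 (Literature.Probability.LatticeModels.torusGraph 2 M) (-1) Δ) ψ = ((Literature.MathematicalPhysics.QuantumLattice.lowestEnergyInSector 1 (Literature.MathematicalPhysics.QuantumLattice.xxzHamiltonian 1 (Literature.Probability.LatticeModels.torusGraph 2 M) (-1) Δ) 0 : ℝ) : ℂ) • ψ → (1 + Δ) / 2 * ((M : ℝ) ^ 2 / 2 * ((M : ℝ) ^ 2 / 2 + 1)) ≤ (star ψ ⬝ᵥ Matrix.mulVec ((∑ x : Literature.Probability.LatticeModels.TorusSite 2 M, Literature.MathematicalPhysics.QuantumLattice.onSite x (Literature.MathematicalPhysics.QuantumLattice.spinRaise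 1)) * (∑ y : Literature.Probability.LatticeModels.TorusSite 2 M, Literature.MathematicalPhysics.QuantumLattice.onSite y (Literature.MathematicalPhysics.QuantumLattice.spinLower 1))) ψ).re) :
    FerroSideChord := by
  intro M _ hE h4 Δ hΔ ψ hmem hψ1 heig
  by_cases hcut : 2 / 5 ≤ Δ
  · exact hEnd M hE h4 Δ ⟨hcut, hΔ.2⟩ ψ hmem hψ1 heig
  · obtain ⟨ψ₀, hmem₀, hψ₀1, heig₀⟩ :=
      exists_unit_sectorGroundState_xy M hE (le_trans (by norm_num) h4)
    have hA := hAnch M hE h4 ψ₀ hmem₀ hψ₀1 heig₀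
    have hM' := hMono M hE h4 0 Δ le_rfl hΔ.1 hΔ.2 ψ₀ ψ hmem₀ hψ₀1 heig₀ hmem hψ1 heig
    have hS : (0:ℝ) ≤ ((M : ℝ) ^ 2 / 2 * ((M : ℝ) ^ 2 / 2 + 1)) := by positivity
    have hc : (1 + Δ) / 2 ≤ 7 / 10 := by linarith [not_le.mp hcut]
    calc (1 + Δ) / 2 * ((M : ℝ) ^ 2 / 2 * ((M : ℝ) ^ 2 / 2 + 1))
        ≤ 7 / 10 * ((M : ℝ) ^ 2 / 2 * ((M : ℝ) ^ 2 / 2 + 1)) := mul_le_mul_of_nonneg_right hc hS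
      _ ≤ _ := hA
      _ ≤ _ := hM'

/-- COMPOSITION TO THE CRUX BY NAME — `ChordFM` from the registered stubs. The split assembly
`ChordXY → FerroSideChord → ChordFM` (= glue item `ChordFMOfPieces`, stmt-19090, whose complete proof is
attached as evidence `AnisotropyChordChordFMOfPieces.lean`) is re-proved INSIDE this theorem so that the
line is self-contained and exactly one theorem of the file concludes the crux. Sorries live only in `stub_*`. -/
theorem ChordFM_of : ChordFM :=
  have pieces : ChordXY → FerroSideChord → ChordFM := by
    intro hXY hF M _ hE h4 Δ hΔ ψ hmem hψ1 heig
    by_cases hΔ0 : 0 ≤ Δ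
    · -- ferromagnetic side `Δ ∈ [0,1]`: the FM-side piece verbatim
      exact hF M hE h4 Δ ⟨hΔ0, hΔ.2⟩ ψ hmem hψ1 heig
    · -- antiferromagnetic side `Δ ∈ [-1,0)`: RP-free anchor at the KLS point, transported by ChordXY
      obtain ⟨ψ₀, hmem₀, hψ₀1, heig₀⟩ :=
        exists_unit_sectorGroundState_xy M hE (le_trans (by norm_num) h4)
      have hA := hF M hE h4 0 ⟨le_rfl, by norm_num⟩ ψ₀ hmem₀ hψ₀1 heig₀
      have hC := hXY M hE h4 Δ ⟨hΔ.1, (not_le.mp hΔ0).le⟩ ψ₀ ψ hmem₀ hψ₀1 heig₀ hmem hψ1 heig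
      have h1 : 0 ≤ 1 + Δ := by linarith [hΔ.1]
      calc (1 + Δ) / 2 * ((M : ℝ) ^ 2 / 2 * ((M : ℝ) ^ 2 / 2 + 1))
          = (1 + Δ) * ((1 + 0) / 2 * ((M : ℝ) ^ 2 / 2 * ((M : ℝ) ^ 2 / 2 + 1))) := by ring
        _ ≤ (1 + Δ) * (star ψ₀ ⬝ᵥ Matrix.mulVec ((∑ x : TorusSite 2 M, onSite x (spinRaise 1)) *
              (∑ y : TorusSite 2 M, onSite y (spinLower 1))) ψ₀).re :=
            mul_le_mul_of_nonneg_left hA h1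
        _ ≤ _ := hC
  pieces stub_chordXY (ferroSideChord_of stub_monotoneFM stub_klsAnchor stub_fmEndChord)

end Summit.HubbardSuperconductivity.HubbardSuperconductivity.Cruxes.ChordFM.FmMonotoneAnchor
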